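import Literature.Barriers.CriticalPhenomena.TimarGoodBoxQuasiTransitive
import Literature.Barriers.CriticalPhenomena.TimarNoLightClustersFirstMoment
import HarnessLib

/-!
# Timár 2006, Thm. 4.3 on QUASI-TRANSITIVE graphs — no infinite light clusters at `p_c` — PROVED

Barrier catalogue `Literature/Barriers/CriticalPhenomena/`. This file proves the quasi-transitive
form of

> **Theorem 4.3** (Á. Timár, *Percolation on nonunimodular transitive graphs*, Ann. Probab. 34
> (2006) 2344–2364). Let `G` be a transitive nonunimodular graph. Then there are no infinite light
> clusters in critical Bernoulli edge percolation on `G`.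

namely `Timar2006_noInfiniteLightClusters_quasiTransitive`: for `G` connected, locally finite,
QUASI-transitive (`IsQuasiTransitive`) and nonunimodular, at `p = p_c`, almost surely every
infinite cluster is heavy — exactly the hypothesis `h43` of
`Hutchcroft2016_noPercolationAtCriticality_of_quasiTransitive_theorems`
(`TimarLevelComponentsQuasiTransitive.lean`), i.e. one of the two halves of the quasi-transitive
Cor. 5.7 quoted by Hutchcroft (2016, §2: "Timár [23] proved that if `G` is a nonunimodular
quasi-transitive graph then `G[p_c]` has at most one infinite cluster almost surely").

The proof is the tree's proof of the transitive theorem (`TimarNoLightClustersFirstMoment.lean`: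
good boxes, first-moment recursion, `E_p̃|C(o)| = ∞` below `p_c` against the finite
susceptibility of Antunović–Veselić 2008) run on the HEIGHTS of a height system
`η : HeightSystem G o` (`TimarHeightsQuasiTransitive.lean`, `TimarGoodBoxQuasiTransitive.lean`)
instead of the weights, with the following changes forced by quasi-transitivity:

* the automorphism `γ_x` carrying the base to `x` exists only from the REPRESENTATIVE `rep x` of
  the orbit of `x` (a finite complete set `R` of representatives,
  `IsQuasiTransitive.exists_orbit_representatives`); the mate of `x` is the image under `γ_x` of
  a long edge at `rep x` (`qtMate`), and "the probability that the box of `x` is good" equals the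
  corresponding probability at `rep x` (`measure_boxGood_qtMate`), the bottom being rescaled by
  `h(rep x)`;
* the facts about the base vertex `o` of `TimarGoodBoxQuasiTransitive.lean` (`q > 0`, the uniform
  choice of `i` and `r`) are applied at every representative `r ∈ R` through the height system
  REBASED at `r` (`HeightSystem.rebase`: gauge divided by `κ(r)`, same ratio; its heights are
  `h(·)/h(r)`, so its boxes, windows, nice events are those of `η` with rescaled thresholds —
  `boxGood_rebase`, `niceEvent_rebase`);
* depth `I` and radius `r` are chosen for all representatives at once (the "eventually" form
  `eventually_depth_radius_boxGood_ge` and `Finset.eventually_all`), the continuity modulus in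
  `p` is taken for the union of the finitely many edge sets, and the lower bound for the good
  events is `q/4` with `q := min_{r ∈ R} P[F(r)] > 0`.

Everything else (`fmThr`, children, generations, regions, the decomposition over the unique
parent, independence of the past, the recursion `E|O_{g+1}| ≥ E|O_g|`, `E|C(o)| = ∞`) is ported
word for word; see `TimarNoLightClustersFirstMoment.lean` for the printed argument.

## References

* Á. Timár, Ann. Probab. 34 (2006) 2344–2364 (arXiv:math/0702875), §4: Lemma 4.2, Thm. 4.3 and
  its proof (pp. 2354–2356). [Timar2006]
* T. Hutchcroft, C. R. Math. Acad. Sci. Paris 354 (2016) 944–947, §2 (the quasi-transitive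
  quotation). [Hutchcroft2016]
* T. Antunović, I. Veselić, J. Stat. Phys. 130 (2008) 983–1009, Thm. 2 (finite susceptibility
  below `p_c` on quasi-transitive graphs). [AntunovicVeselic2007]
* P. Tang, Ann. Probab. 47 (2019), §4 ("the proof can be easily adapted"). [Tang2019]
-/

noncomputable section

namespace Literature.Barriers.CriticalPhenomena

open _root_.MeasureTheory _root_.Filter Literature.Probability.Percolation
open scoped _root_.ENNReal _root_.Topology

variable {V : Type*}

namespace HeightSystem

/-! ### Rebasing a height system at another vertex -/

section Rebase

variable {G : SimpleGraph V} [G.LocallyFinite] {o : V} (η : HeightSystem G o)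

/-- The key identity of the rebasing: `κ(v) κ(r)⁻¹ w_r(v) = h(v) h(r)⁻¹`. [folklore] -/
theorem gauge_mul_inv_mul_autWeight (hconn : G.Connected) (r v : V) :
    η.gauge v * (η.gauge r)⁻¹ * autWeight G r v = η.height v * (η.height r)⁻¹ := by
  have hw : autWeight G r v = autWeight G o v / autWeight G o r := by
    rw [ENNReal.eq_div_iff (autWeight_ne_zero G hconn o r) (autWeight_ne_top G hconn o r), mul_comm]
    exact autWeight_base_mul G hconn o r v
  have hinv : (η.height r)⁻¹ = (η.gauge r)⁻¹ * (autWeight G o r)⁻¹ :=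
    ENNReal.mul_inv (Or.inl (η.gauge_ne_zero r)) (Or.inl (η.gauge_ne_top r))
  rw [hw, hinv, height, div_eq_mul_inv]
  ring

/-- **The height system rebased at `r`**: gauge `κ(·)/κ(r)`, same ratio `Δ`; a height system for
the weights based at `r`, whose heights are `h(·)/h(r)` (`height_rebase`).
[cite: Timar2006, §2 (weights independent of o up to a constant factor)] -/
def rebase (hconn : G.Connected) (r : V) : HeightSystem G r where
  gauge v := η.gauge v * (η.gauge r)⁻¹
  ratio := η.ratio
  lower := η.lower * (η.gauge r)⁻¹
  upper := η.upper * (η.gauge r)⁻¹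
  gauge_map γ x := by rw [η.gauge_map]
  gauge_base := ENNReal.mul_inv_cancel (η.gauge_ne_zero r) (η.gauge_ne_top r)
  lower_ne_zero := mul_ne_zero η.lower_ne_zero (ENNReal.inv_ne_zero.2 (η.gauge_ne_top r))
  upper_ne_top := ENNReal.mul_ne_top η.upper_ne_top (ENNReal.inv_ne_top.2 (η.gauge_ne_zero r))
  lower_le x := mul_le_mul' (η.lower_le x) le_rfl
  le_upper x := mul_le_mul' (η.le_upper x) le_rfl
  ratio_ne_zero := η.ratio_ne_zero
  ratio_lt_one := η.ratio_lt_one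
  ratio_mul_le x y hxy := by
    rw [η.gauge_mul_inv_mul_autWeight hconn r x, η.gauge_mul_inv_mul_autWeight hconn r y,
      ← mul_assoc]
    exact mul_le_mul' (η.ratio_mul_height_le hxy) le_rfl
  exists_adj_eq x := by
    obtain ⟨y, hxy, hy⟩ := η.exists_adj_height_eq x
    refine ⟨y, hxy, ?_⟩
    rw [η.gauge_mul_inv_mul_autWeight hconn r x, η.gauge_mul_inv_mul_autWeight hconn r y, hy,
      mul_assoc]

/-- The ratio is unchanged. [folklore] -/
@[simp] theorem ratio_rebase (hconn : G.Connected) (r : V) : (η.rebase hconn r).ratio = η.ratio := rfl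

/-- **The rebased heights are `h(·)/h(r)`.** [folklore] -/
theorem height_rebase (hconn : G.Connected) (r v : V) :
    (η.rebase hconn r).height v = η.height v * (η.height r)⁻¹ :=
  η.gauge_mul_inv_mul_autWeight hconn r v

/-- Comparison of a rebased height with a rescaled threshold: `A < h(v)/h(r) ↔ h(r) A < h(v)`.
[folklore] -/
theorem lt_height_rebase_iff (hconn : G.Connected) (r : V) {v : V} {A : ℝ≥0∞} :
    A < (η.rebase hconn r).height v ↔ η.height r * A < η.height v := by
  have h0 := η.height_ne_zero hconn r
  have hT := η.height_ne_top hconn r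
  rw [height_rebase, ← div_eq_mul_inv, ENNReal.lt_div_iff_mul_lt (Or.inl h0) (Or.inl hT), mul_comm]

/-- `h(v)/h(r) ≤ A ↔ h(v) ≤ h(r) A`. [folklore] -/
theorem height_rebase_le_iff (hconn : G.Connected) (r : V) {v : V} {A : ℝ≥0∞} :
    (η.rebase hconn r).height v ≤ A ↔ η.height v ≤ η.height r * A := by
  rw [← not_lt, lt_height_rebase_iff, not_lt]

/-- Comparisons between two rebased heights are comparisons between heights. [folklore] -/
theorem height_rebase_le_mul_iff (hconn : G.Connected) (r : V) {u v : V} {c : ℝ≥0∞} :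
    (η.rebase hconn r).height u ≤ c * (η.rebase hconn r).height v ↔ η.height u ≤ c * η.height v := by
  have h0 : (η.height r)⁻¹ ≠ 0 := ENNReal.inv_ne_zero.2 (η.height_ne_top hconn r)
  have hT : (η.height r)⁻¹ ≠ ⊤ := ENNReal.inv_ne_top.2 (η.height_ne_zero hconn r)
  rw [height_rebase, height_rebase, ← mul_assoc]
  exact ENNReal.mul_le_mul_iff_left h0 hT

/-- Rebasing does not change `lowSet`. [folklore] -/
theorem lowSet_rebase (hconn : G.Connected) (r x : V) : (η.rebase hconn r).lowSet x = η.lowSet x := by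
  ext v
  exact η.height_rebase_le_mul_iff hconn r

/-- Rebasing does not change `G'(x)`. [folklore] -/
theorem lowerGraph_rebase (hconn : G.Connected) (r x x' : V) :
    (η.rebase hconn r).lowerGraph x x' = η.lowerGraph x x' := by
  ext u v
  simp only [lowerGraph_adj, lowSet_rebase]

/-- Rebasing rescales the bottom of a box: `boxSet' x A ρ = boxSet x (h(r) A) ρ`. [folklore] -/
theorem boxSet_rebase (hconn : G.Connected) (r x : V) (A : ℝ≥0∞) (ρ : ℕ) :
    (η.rebase hconn r).boxSet x A ρ = η.boxSet x (η.height r * A) ρ := by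
  ext v
  simp only [boxSet, Set.mem_inter_iff, Set.mem_setOf_eq, lt_height_rebase_iff]

/-- Rebasing and the step graph of a box. [folklore] -/
theorem boxStepGraph_rebase (hconn : G.Connected) (r x x' : V) (A : ℝ≥0∞) (ρ : ℕ) :
    (η.rebase hconn r).boxStepGraph x x' A ρ = η.boxStepGraph x x' (η.height r * A) ρ := by
  rw [boxStepGraph, boxStepGraph, lowerGraph_rebase, boxSet_rebase]

/-- Rebasing and the component of a box. [folklore] -/
theorem boxCluster_rebase (hconn : G.Connected) (r x x' : V) (A : ℝ≥0∞) (ρ : ℕ) (ω : BondConfig V) :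
    (η.rebase hconn r).boxCluster x x' A ρ ω = η.boxCluster x x' (η.height r * A) ρ ω := by
  rw [boxCluster, boxCluster, boxStepGraph_rebase]

/-- Rebasing and sealedness. [folklore] -/
theorem boxSealed_rebase_iff (hconn : G.Connected) (r x x' : V) (A : ℝ≥0∞) (ρ : ℕ)
    (ω : BondConfig V) :
    (η.rebase hconn r).BoxSealed x x' A ρ ω ↔ η.BoxSealed x x' (η.height r * A) ρ ω := by
  simp only [BoxSealed, boxCluster_rebase, boxSet_rebase, lowSet_rebase, height_rebase_le_iff]

/-- Rebasing rescales windows. [folklore] -/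
theorem wwindow_rebase (hconn : G.Connected) (r : V) (A : ℝ≥0∞) :
    (η.rebase hconn r).wwindow A = η.wwindow (η.height r * A) := by
  ext v
  simp only [wwindow, Set.mem_setOf_eq, lt_height_rebase_iff, height_rebase_le_iff, ratio_rebase,
    mul_assoc]

/-- **Rebasing rescales the bottom of the good event**: `boxGood' x x' A ρ k = boxGood x x' (h(r) A) ρ k`.
[folklore] -/
theorem boxGood_rebase (hconn : G.Connected) (r x x' : V) (A : ℝ≥0∞) (ρ k : ℕ) :
    (η.rebase hconn r).boxGood x x' A ρ k = η.boxGood x x' (η.height r * A) ρ k := by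
  ext ω
  simp only [boxGood, Set.mem_setOf_eq, boxCluster_rebase, boxSealed_rebase_iff, wwindow_rebase]

/-- Rebasing does not change niceness. [folklore] -/
theorem isNice_rebase_iff (hconn : G.Connected) (r x x' : V) (ω : BondConfig V) :
    (η.rebase hconn r).IsNice x x' ω ↔ η.IsNice x x' ω := by
  simp only [IsNice, lowSet_rebase]

/-- **Rebasing does not change the event `F(x)`** (heaviness does not depend on the base vertex,
`isHeavy_iff_of_base`). [folklore] -/
theorem niceEvent_rebase (hconn : G.Connected) (r x x' : V) :
    (η.rebase hconn r).niceEvent x x' = η.niceEvent x x' := by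
  ext ω
  simp only [niceEvent, Set.mem_setOf_eq, isNice_rebase_iff, isHeavy_iff_of_base G hconn o r]

end Rebase

/-! ### Orbit representatives, the automorphisms `γ_x` and the mates on a quasi-transitive graph -/

section Reps

variable {G : SimpleGraph V} [G.LocallyFinite] {o : V} (η : HeightSystem G o)
variable {R : Finset V} (hR : ∀ v : V, ∃ r ∈ R, v ∈ autOrbit G r)

/-- The representative of the orbit of `x`. [cite: LyonsPeres2016, Cor. 8.11 ("a complete set of representatives")] -/
def rep (hR : ∀ v : V, ∃ r ∈ R, v ∈ autOrbit G r) (x : V) : V := Classical.choose (hR x)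

omit [G.LocallyFinite] in
/-- `rep x ∈ R`. [folklore] -/
theorem rep_mem (x : V) : rep hR x ∈ R := (Classical.choose_spec (hR x)).1

omit [G.LocallyFinite] in
/-- `x` lies in the orbit of `rep x`. [folklore] -/
theorem mem_autOrbit_rep (x : V) : x ∈ autOrbit G (rep hR x) := (Classical.choose_spec (hR x)).2

/-- "Some (arbitrarily fixed) automorphism of `G`" taking `rep x` to `x` (quasi-transitive
replacement of the printed `γ_x : o ↦ x`). [cite: Timar2006, §4 (proof of Thm. 4.3: definition of G′(x))] -/
def qtAutTo (hR : ∀ v : V, ∃ r ∈ R, v ∈ autOrbit G r) (x : V) : G ≃g G :=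
  Classical.choose (mem_autOrbit_rep hR x)

omit [G.LocallyFinite] in
/-- `γ_x (rep x) = x`. [folklore] -/
@[simp] theorem qtAutTo_apply (x : V) : qtAutTo hR x (rep hR x) = x :=
  Classical.choose_spec (mem_autOrbit_rep hR x)

/-- The long edge chosen at a vertex `r` (used at the representatives): a neighbour of height
exactly `Δ h(r)`. [cite: Timar2006, §4 (proof of Thm. 4.3: "Fix some o' below o which is connected to o by some long edge")] -/
def longMate (η : HeightSystem G o) (r : V) : V := Classical.choose (η.exists_adj_height_eq r)

omit [G.LocallyFinite] in
/-- The long mate is a neighbour. [folklore] -/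
theorem adj_longMate (r : V) : G.Adj r (η.longMate r) :=
  (Classical.choose_spec (η.exists_adj_height_eq r)).1

omit [G.LocallyFinite] in
/-- The long mate lies one long edge below: `h(r') = Δ h(r)`. [folklore] -/
theorem height_longMate (r : V) : η.height (η.longMate r) = η.ratio * η.height r :=
  (Classical.choose_spec (η.exists_adj_height_eq r)).2

/-- The **mate** `x' := γ_x ((rep x)')` of `x`: the far end of the long edge of `G′(x)` at `x`.
[cite: Timar2006, §4 (proof of Thm. 4.3: G′(x), x′)] -/
def qtMate (η : HeightSystem G o) (hR : ∀ v : V, ∃ r ∈ R, v ∈ autOrbit G r) (x : V) : V :=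
  qtAutTo hR x (η.longMate (rep hR x))

omit [G.LocallyFinite] in
/-- The mate is a neighbour. [folklore] -/
theorem adj_qtMate (x : V) : G.Adj x (η.qtMate hR x) := by
  have h := (SimpleGraph.Iso.map_adj_iff (qtAutTo hR x)).2 (η.adj_longMate (rep hR x))
  rwa [qtAutTo_apply] at h

/-- The mate lies one long edge below: `h(x') = Δ h(x)`. [cite: Timar2006, §4 (proof of Thm. 4.3: long edges)] -/
theorem height_qtMate (hconn : G.Connected) (x : V) :
    η.height (η.qtMate hR x) = η.ratio * η.height x := by
  rw [qtMate, η.height_map_eq_mul hconn (qtAutTo hR x), height_longMate]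
  have hx : η.height x = η.height (qtAutTo hR x o) * η.height (rep hR x) := by
    conv_lhs => rw [← qtAutTo_apply hR x]
    exact η.height_map_eq_mul hconn (qtAutTo hR x) (rep hR x)
  rw [hx]; ring

/-- The mate is low for `x`. [folklore] -/
theorem qtMate_mem_lowSet (hconn : G.Connected) (x : V) : η.qtMate hR x ∈ η.lowSet x := by
  show η.height (η.qtMate hR x) ≤ η.ratio * η.height x
  rw [η.height_qtMate hR hconn x]

/-- **The good event at `x` is as likely as the corresponding good event at `rep x`** ("these
events can be mapped into each other by some automorphisms", p. 2354): the box of `x` with mate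
`x'` and bottom `h(x) · a` is the image under `γ_x` of the box of `rep x` with its long mate and
bottom `h(rep x) · a`. [cite: Timar2006, §4 (proof of Thm. 4.3: P[F(x)] is independent of x)] -/
theorem measure_boxGood_qtMate (hconn : G.Connected) (p : unitInterval) (x : V) (a : ℝ≥0∞)
    (ρ k : ℕ) :
    bondPercolation G p (η.boxGood x (η.qtMate hR x) (η.height x * a) ρ k) =
      bondPercolation G p (η.boxGood (rep hR x) (η.longMate (rep hR x))
        (η.height (rep hR x) * a) ρ k) := by
  have h := η.measure_boxGood_map hconn (qtAutTo hR x) p (rep hR x) (η.longMate (rep hR x))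
    (η.height (rep hR x) * a) ρ k
  rw [qtAutTo_apply] at h
  have hthr : η.height (qtAutTo hR x o) * (η.height (rep hR x) * a) = η.height x * a := by
    rw [← mul_assoc, ← η.height_map_eq_mul hconn (qtAutTo hR x) (rep hR x), qtAutTo_apply]
  rw [hthr] at h
  exact h

end Reps

/-! ### Children and generations -/

section Process

variable {G : SimpleGraph V} [G.LocallyFinite] {o : V} (η : HeightSystem G o)
variable {R : Finset V} (hR : ∀ v : V, ∃ r ∈ R, v ∈ autOrbit G r)

/-- The bottom threshold of the boxes of the slab-`b` vertices (depth `I`): `Δ^{b+I+1}`.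
[cite: Timar2006, §4 (proof of Thm. 4.3: B_x(i; r) ⊆ G(ℓ_{j+i}, ℓ_j])] -/
def fmThr (η : HeightSystem G o) (I b : ℕ) : ℝ≥0∞ := η.ratio ^ (b + I + 1)

/-- The **children** of a vertex `x` of the slab `b` (see `fmChildren` of
`TimarNoLightClustersFirstMoment.lean`). [cite: Timar2006, §4 (proof of Thm. 4.3: the children in T)] -/
def fmChildren (η : HeightSystem G o) (hR : ∀ v : V, ∃ r ∈ R, v ∈ autOrbit G r) (I ρ b : ℕ) (x : V)
    (ω : BondConfig V) : Set V :=
  {c | x ∈ η.slab b ∧ η.BoxSealed x (η.qtMate hR x) (η.fmThr I b) ρ ω ∧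
    c ∈ η.boxCluster x (η.qtMate hR x) (η.fmThr I b) ρ ω ∧ c ∈ η.slab (b + I)}

/-- The **generations** `O_g`: `O_0 = {o}`, `O_{g+1}` = the children of the vertices of `O_g`.
[cite: Timar2006, §4 (proof of Thm. 4.3: the generations O_g of T)] -/
def fmGen (η : HeightSystem G o) (hR : ∀ v : V, ∃ r ∈ R, v ∈ autOrbit G r) (I ρ : ℕ)
    (ω : BondConfig V) : ℕ → Set V
  | 0 => {o}
  | g + 1 => ⋃ x ∈ fmGen η hR I ρ ω g, η.fmChildren hR I ρ (g * I) x ω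

/-- `O_0 = {o}`. [folklore] -/
theorem fmGen_zero (I ρ : ℕ) (ω : BondConfig V) : η.fmGen hR I ρ ω 0 = {o} := rfl

/-- `O_{g+1}` unfolded. [folklore] -/
theorem mem_fmGen_succ_iff (I ρ : ℕ) (ω : BondConfig V) (g : ℕ) (c : V) :
    c ∈ η.fmGen hR I ρ ω (g + 1) ↔ ∃ x ∈ η.fmGen hR I ρ ω g, c ∈ η.fmChildren hR I ρ (g * I) x ω := by
  show c ∈ ⋃ x ∈ η.fmGen hR I ρ ω g, η.fmChildren hR I ρ (g * I) x ω ↔ _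
  simp only [Set.mem_iUnion, exists_prop]

/-- Children lie in the next generation's slab. [cite: Timar2006, §4 (proof of Thm. 4.3: O_{g+1} ⊆ G(ℓ_{(g+1)i+1}, ℓ_{(g+1)i}])] -/
theorem fmChildren_subset_slab (I ρ b : ℕ) (x : V) (ω : BondConfig V) :
    η.fmChildren hR I ρ b x ω ⊆ η.slab (b + I) :=
  fun _ hc => hc.2.2.2

/-- Children lie in the open cluster of their parent. [cite: Timar2006, §4 (proof of Thm. 4.3: "the corresponding vertices in G all belong to one (infinite) open cluster")] -/
theorem fmChildren_subset_openCluster (I ρ b : ℕ) (x : V) (ω : BondConfig V) :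
    η.fmChildren hR I ρ b x ω ⊆ openCluster ω x :=
  fun _ hc => η.boxCluster_subset_openCluster _ _ _ _ ω hc.2.2.1

/-- **`O_g ⊆ G(ℓ_{gI+1}, ℓ_{gI}] ∩ C(o)`.** [cite: Timar2006, §4 (proof of Thm. 4.3, pp. 2354–2356)] -/
theorem fmGen_subset (hconn : G.Connected) (I ρ : ℕ) (ω : BondConfig V) :
    ∀ g : ℕ, η.fmGen hR I ρ ω g ⊆ η.slab (g * I) ∩ openCluster ω o
  | 0 => by
    intro c hc
    have hc' : c = o := by simpa [fmGen_zero] using hc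
    subst hc'
    rw [zero_mul]
    exact ⟨η.mem_slab_zero hconn, mem_openCluster_self ω _⟩
  | g + 1 => by
    intro c hc
    obtain ⟨x, hx, hcx⟩ := (η.mem_fmGen_succ_iff hR I ρ ω g c).1 hc
    obtain ⟨-, hxo⟩ := fmGen_subset hconn I ρ ω g hx
    refine ⟨?_, ?_⟩
    · have h := η.fmChildren_subset_slab hR I ρ (g * I) x ω hcx
      rwa [show g * I + I = (g + 1) * I by ring] at h
    · rw [← openCluster_eq_openCluster_of_mem hxo]
      exact η.fmChildren_subset_openCluster hR I ρ _ x ω hcx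

omit [G.LocallyFinite] in
/-- The bottom threshold lies below the slab: `Δ^{b+I+1} < h(x)` for `x ∈ slab b`. [folklore] -/
theorem fmThr_lt_height {I b : ℕ} {x : V} (hx : x ∈ η.slab b) : η.fmThr I b < η.height x :=
  lt_of_le_of_lt (η.ratio_pow_le_pow_iff.2 (by omega)) hx.1

/-- A slab-`b` vertex lies in its own box. [folklore] -/
theorem mem_boxSet_of_mem_slab {I b : ℕ} {x : V} (hx : x ∈ η.slab b) (ρ : ℕ) :
    x ∈ η.boxSet x (η.fmThr I b) ρ :=
  η.mem_boxSet_self (η.fmThr_lt_height hx) ρ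

omit [G.LocallyFinite] in
/-- Within one slab no vertex is low for another. [folklore] -/
theorem not_mem_lowSet_of_mem_slab {b : ℕ} {x y : V} (hx : x ∈ η.slab b) (hy : y ∈ η.slab b) :
    y ∉ η.lowSet x := by
  intro h
  have h' : η.height y ≤ η.ratio * η.height x := h
  have : η.ratio * η.height x ≤ η.ratio ^ (b + 1) := by
    rw [pow_succ, mul_comm]
    gcongr
    exact hx.2
  exact absurd (lt_of_lt_of_le hy.1 (h'.trans this)) (lt_irrefl _)

/-- **Children of distinct parents are disjoint.** [cite: Timar2006, §4 (proof of Thm. 4.3: "distinct vertices in T correspond to distinct vertices in C(o)")] -/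
theorem fmChildren_disjoint (hconn : G.Connected) (I ρ b : ℕ) {x y : V} (hxy : x ≠ y)
    (ω : BondConfig V) :
    Disjoint (η.fmChildren hR I ρ b x ω) (η.fmChildren hR I ρ b y ω) := by
  rw [Set.disjoint_left]
  intro c hcx hcy
  have hx := hcx.1
  have hy := hcy.1
  have hd := η.boxCluster_disjoint_of_sealed hconn (η.qtMate_mem_lowSet hR hconn x)
    (η.qtMate_mem_lowSet hR hconn y) (η.mem_boxSet_of_mem_slab hx ρ) hxy
    (η.not_mem_lowSet_of_mem_slab hx hy) (η.not_mem_lowSet_of_mem_slab hy hx) (s := ρ) hcx.2.1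
  exact Set.disjoint_left.1 hd hcx.2.2.1 hcy.2.2.1

/-! ### The regions of edges read by the generations -/

/-- The **region** of the slab-`b` boxes: the edges with both endpoints of height `> Δ^{b+I+1}`
and some endpoint of height `≤ Δ^{b+1}`. [cite: Timar2006, §4 (proof of Thm. 4.3: the edge sets of the boxes of one generation)] -/
def fmRegion (η : HeightSystem G o) (I b : ℕ) : Set (Sym2 V) :=
  {e | (∀ u ∈ e, η.fmThr I b < η.height u) ∧ ∃ u ∈ e, η.height u ≤ η.ratio ^ (b + 1)}

/-- The edges of the box of a slab-`b` vertex lie in the region of the slab `b`.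
[cite: Timar2006, §4 (proof of Thm. 4.3: the edge sets in B_x)] -/
theorem boxEdges_subset_fmRegion (hconn : G.Connected) (I ρ : ℕ) {b : ℕ} {x : V}
    (hx : x ∈ η.slab b) :
    η.boxEdges x (η.qtMate hR x) (η.fmThr I b) ρ ⊆ η.fmRegion I b := by
  intro e he
  obtain ⟨hall, u, hu, hulow⟩ := η.boxEdges_weight (η.qtMate_mem_lowSet hR hconn x) he
  refine ⟨hall, u, hu, ?_⟩
  calc η.height u ≤ η.ratio * η.height x := hulow
    _ ≤ η.ratio * η.ratio ^ b := by gcongr; exact hx.2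
    _ = η.ratio ^ (b + 1) := by ring

omit [G.LocallyFinite] in
/-- **The regions of different generations are disjoint** (`b + I ≤ b'`).
[cite: Timar2006, §4 (proof of Thm. 4.3: "the edge sets in B_x and B_y are disjoint whenever … g ≠ g′")] -/
theorem fmRegion_disjoint {I b b' : ℕ} (h : b + I ≤ b') :
    Disjoint (η.fmRegion I b) (η.fmRegion I b') := by
  rw [Set.disjoint_left]
  rintro e ⟨habove, -⟩ ⟨-, u, hu, hle⟩
  have h1 := habove u hu
  have h2 : η.ratio ^ (b' + 1) ≤ η.fmThr I b := η.ratio_pow_le_pow_iff.2 (by omega)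
  exact absurd (lt_of_lt_of_le h1 (hle.trans h2)) (lt_irrefl _)

omit [G.LocallyFinite] in
/-- The union of the regions of the generations before `g` is disjoint from the region of
generation `g`. [folklore] -/
theorem iUnion_fmRegion_disjoint (I g : ℕ) :
    Disjoint (⋃ j ∈ Finset.range g, η.fmRegion I (j * I)) (η.fmRegion I (g * I)) := by
  rw [Set.disjoint_iUnion₂_left]
  intro j hj
  refine η.fmRegion_disjoint ?_
  have hj' : j + 1 ≤ g := Finset.mem_range.1 hj
  calc j * I + I = (j + 1) * I := by ring
    _ ≤ g * I := Nat.mul_le_mul_right _ hj'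

/-! ### The events "`c` is a child of `x`" and "`x ∈ O_g`", and what they depend on -/

/-- The event "`c` is a slab-`b` child of `x`". [folklore] -/
def fmChildEvent (η : HeightSystem G o) (hR : ∀ v : V, ∃ r ∈ R, v ∈ autOrbit G r) (I ρ b : ℕ)
    (x c : V) : Set (BondConfig V) :=
  {ω | c ∈ η.fmChildren hR I ρ b x ω}

/-- The event "`x ∈ O_g`". [folklore] -/
def fmGenEvent (η : HeightSystem G o) (hR : ∀ v : V, ∃ r ∈ R, v ∈ autOrbit G r) (I ρ g : ℕ)
    (x : V) : Set (BondConfig V) :=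
  {ω | x ∈ η.fmGen hR I ρ ω g}

/-- `O_0`-membership is a constant event. [folklore] -/
theorem fmGenEvent_zero (I ρ : ℕ) (x : V) : η.fmGenEvent hR I ρ 0 x = {_ω | x = o} := by
  ext ω
  simp [fmGenEvent, fmGen_zero]

/-- `O_{g+1}`-membership as a union over the parents. [folklore] -/
theorem fmGenEvent_succ (I ρ g : ℕ) (c : V) :
    η.fmGenEvent hR I ρ (g + 1) c =
      ⋃ x : V, η.fmGenEvent hR I ρ g x ∩ η.fmChildEvent hR I ρ (g * I) x c := by
  ext ω
  simp only [fmGenEvent, fmChildEvent, Set.mem_setOf_eq, mem_fmGen_succ_iff, Set.mem_iUnion,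
    Set.mem_inter_iff]

/-- **The children of `x` only depend on the edges of `x`'s box**, hence on the region of the slab
of `x`. [cite: Timar2006, §4 (proof of Thm. 4.3: the numbers of children only depend on the edges of the boxes)] -/
theorem determinedBy_fmChildEvent (hconn : G.Connected) (I ρ b : ℕ) (x c : V) :
    DeterminedBy (η.fmChildEvent hR I ρ b x c) (η.fmRegion I b) := by
  by_cases hx : x ∈ η.slab b
  · refine DeterminedBy.mono ?_ (η.boxEdges_subset_fmRegion hR hconn I ρ hx)
    rw [determinedBy_iff]
    intro ω ω' h
    have hK := η.boxCluster_eq_of_inter_eq (x := x) (x' := η.qtMate hR x) (A := η.fmThr I b)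
      (r := ρ) h
    have hlow := η.qtMate_mem_lowSet hR hconn x
    have hxA := η.mem_boxSet_of_mem_slab (I := I) hx ρ
    simp only [fmChildEvent, fmChildren, Set.mem_setOf_eq, hK]
    exact ⟨fun ⟨h1, h2, h3, h4⟩ => ⟨h1, η.boxSealed_of_inter_eq hlow hxA h h2, h3, h4⟩,
      fun ⟨h1, h2, h3, h4⟩ => ⟨h1, η.boxSealed_of_inter_eq hlow hxA h.symm h2, h3, h4⟩⟩
  · refine determinedBy_of_forall_iff (fun ω ω' => ?_) _
    simp only [fmChildEvent, fmChildren, Set.mem_setOf_eq, hx, false_and]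

/-- **`{x ∈ O_g}` only depends on the edges of the regions of the earlier generations.**
[cite: Timar2006, §4 (proof of Thm. 4.3: "P[|O_{m+1}| = i | O_m, …, O_0] = P[|O_{m+1}| = i | O_m]")] -/
theorem determinedBy_fmGenEvent (hconn : G.Connected) (I ρ : ℕ) :
    ∀ (g : ℕ) (x : V), DeterminedBy (η.fmGenEvent hR I ρ g x)
      (⋃ j ∈ Finset.range g, η.fmRegion I (j * I))
  | 0, x => by
    rw [fmGenEvent_zero]
    exact determinedBy_of_forall_iff (fun _ _ => Iff.rfl) _
  | g + 1, c => by
    rw [fmGenEvent_succ]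
    refine determinedBy_iUnion fun x => DeterminedBy.inter ?_ ?_
    · refine (determinedBy_fmGenEvent hconn I ρ g x).mono ?_
      exact Set.biUnion_subset_biUnion_left fun j hj => by
        simp only [Finset.coe_range, Set.mem_Iio] at hj ⊢; omega
    · refine (η.determinedBy_fmChildEvent hR hconn I ρ (g * I) x c).mono ?_
      exact Set.subset_biUnion_of_mem (u := fun j => η.fmRegion I (j * I))
        (Finset.mem_coe.2 (Finset.self_mem_range_succ g))

/-- "`c` is a child of `x`" is measurable. [folklore] -/
theorem measurableSet_fmChildEvent [Countable V] (I ρ b : ℕ) (x c : V) :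
    MeasurableSet (η.fmChildEvent hR I ρ b x c) := by
  have heq : η.fmChildEvent hR I ρ b x c =
      {_ω | x ∈ η.slab b} ∩ ({ω | η.BoxSealed x (η.qtMate hR x) (η.fmThr I b) ρ ω} ∩
        ({ω | c ∈ η.boxCluster x (η.qtMate hR x) (η.fmThr I b) ρ ω} ∩
          {_ω | c ∈ η.slab (b + I)})) := by
    ext ω; simp only [fmChildEvent, fmChildren, Set.mem_setOf_eq, Set.mem_inter_iff]
  rw [heq]
  exact (measurableSet_setOf_const _).inter ((η.measurableSet_boxSealed x _ _ ρ).inter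
    ((η.measurableSet_mem_boxCluster x _ _ ρ c).inter (measurableSet_setOf_const _)))

/-- "`x ∈ O_g`" is measurable. [folklore] -/
theorem measurableSet_fmGenEvent [Countable V] (I ρ : ℕ) :
    ∀ (g : ℕ) (x : V), MeasurableSet (η.fmGenEvent hR I ρ g x)
  | 0, x => by
    rw [fmGenEvent_zero]
    exact measurableSet_setOf_const _
  | g + 1, c => by
    rw [fmGenEvent_succ]
    exact MeasurableSet.iUnion fun x =>
      (measurableSet_fmGenEvent I ρ g x).inter (η.measurableSet_fmChildEvent hR I ρ _ x c)

end Process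

/-! ### The first-moment recursion `E|O_{g+1}| ≥ E|O_g|` and `E|C(o)| = ∞` -/

section FirstMoment

variable {G : SimpleGraph V} [G.LocallyFinite] {o : V} (η : HeightSystem G o)
variable {R : Finset V} (hR : ∀ v : V, ∃ r ∈ R, v ∈ autOrbit G r)

omit [G.LocallyFinite] in
/-- The window above `Δ^{j+1}` is the slab `j`. [folklore] -/
theorem wwindow_pow_succ (j : ℕ) : η.wwindow (η.ratio ^ (j + 1)) = η.slab j := by
  have hpow : η.ratio ^ (j + 1) * η.ratio⁻¹ = η.ratio ^ j := by
    rw [pow_succ, mul_assoc, ENNReal.mul_inv_cancel η.ratio_ne_zero η.ratio_ne_top, mul_one]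
  ext v
  simp only [wwindow, slab, Set.mem_setOf_eq, hpow]

/-- **On the good event of a slab-`b` vertex it has at least `k` children.**
[cite: Timar2006, §4 (proof of Thm. 4.3: f ≥ k by being good)] -/
theorem le_encard_fmChildren_of_mem_boxGood {I ρ k b : ℕ} {x : V} (hx : x ∈ η.slab b)
    {ω : BondConfig V} (hω : ω ∈ η.boxGood x (η.qtMate hR x) (η.fmThr I b) ρ k) :
    (k : ℕ∞) ≤ (η.fmChildren hR I ρ b x ω).encard := by
  obtain ⟨hk, hseal⟩ := hω
  have hw : η.wwindow (η.fmThr I b) = η.slab (b + I) := by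
    rw [fmThr, show b + I + 1 = (b + I) + 1 by ring]
    exact η.wwindow_pow_succ (b + I)
  rw [hw] at hk
  refine hk.trans (Set.encard_le_encard ?_)
  rintro c ⟨hcK, hcs⟩
  exact ⟨hx, hseal, hcK, hcs⟩

/-- **The expected number of children of a slab-`b` vertex is at least `k · P[its box is good]`.**
[cite: Timar2006, §4 (proof of Thm. 4.3: a vertex has ≥ k children with probability > q/(2δ))] -/
theorem mul_measure_boxGood_le_tsum [Countable V] (p : unitInterval) {I ρ k b : ℕ} {x : V}
    (hx : x ∈ η.slab b) :
    (k : ℝ≥0∞) * bondPercolation G p (η.boxGood x (η.qtMate hR x) (η.fmThr I b) ρ k) ≤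
      ∑' c, bondPercolation G p (η.fmChildEvent hR I ρ b x c) := by
  set μ := bondPercolation G p with hμ
  set B := η.boxGood x (η.qtMate hR x) (η.fmThr I b) ρ k with hB
  have hBm : MeasurableSet B := η.measurableSet_boxGood (η.mem_boxSet_of_mem_slab hx ρ) k
  have hKm : ∀ c, MeasurableSet (η.fmChildEvent hR I ρ b x c) :=
    fun c => η.measurableSet_fmChildEvent hR I ρ b x c
  have hpt : ∀ ω, B.indicator (fun _ => (k : ℝ≥0∞)) ω ≤
      ∑' c, (η.fmChildEvent hR I ρ b x c ∩ B).indicator 1 ω := by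
    intro ω
    by_cases hω : ω ∈ B
    · rw [Set.indicator_of_mem hω]
      have heq : ∀ c, (η.fmChildEvent hR I ρ b x c ∩ B).indicator (1 : BondConfig V → ℝ≥0∞) ω =
          (η.fmChildren hR I ρ b x ω).indicator (fun _ => (1 : ℝ≥0∞)) c := by
        intro c
        by_cases hc : c ∈ η.fmChildren hR I ρ b x ω
        · rw [Set.indicator_of_mem hc, Set.indicator_of_mem (show ω ∈ _ ∩ B from ⟨hc, hω⟩)]
          rfl
        · rw [Set.indicator_of_notMem hc, Set.indicator_of_notMem]
          exact fun h => hc h.1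
      rw [tsum_congr heq, tsum_indicator_const, mul_one]
      have h := η.le_encard_fmChildren_of_mem_boxGood hR hx hω
      exact_mod_cast ENat.toENNReal_le.2 h
    · rw [Set.indicator_of_notMem hω]
      exact bot_le
  calc (k : ℝ≥0∞) * μ B = ∫⁻ ω, B.indicator (fun _ => (k : ℝ≥0∞)) ω ∂μ :=
        (lintegral_indicator_const hBm _).symm
    _ ≤ ∫⁻ ω, ∑' c, (η.fmChildEvent hR I ρ b x c ∩ B).indicator 1 ω ∂μ :=
        lintegral_mono fun ω => hpt ω
    _ = ∑' c, ∫⁻ ω, (η.fmChildEvent hR I ρ b x c ∩ B).indicator 1 ω ∂μ :=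
        lintegral_tsum fun c => (measurable_one.indicator ((hKm c).inter hBm)).aemeasurable
    _ = ∑' c, μ (η.fmChildEvent hR I ρ b x c ∩ B) :=
        tsum_congr fun c => lintegral_indicator_one ((hKm c).inter hBm)
    _ ≤ ∑' c, μ (η.fmChildEvent hR I ρ b x c) :=
        ENNReal.tsum_le_tsum fun c => measure_mono Set.inter_subset_left

/-- **The relative bottom of a slab-`b` vertex**: `Δ^{b+I+1} = h(x) · a` with `a ∈ [Δ^{I+1}, Δ^I)`.
[cite: Timar2006, §4 (proof of Thm. 4.3: "Clearly, there is also a uniform choice, so that B_x(i; r) is good for any x below o")] -/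
theorem exists_relThr (hconn : G.Connected) {I b : ℕ} {x : V} (hx : x ∈ η.slab b) :
    ∃ a : ℝ≥0∞, η.ratio ^ (I + 1) ≤ a ∧ a < η.ratio ^ I ∧ η.height x * a = η.fmThr I b := by
  have hw0 := η.height_ne_zero hconn x
  have hwT := η.height_ne_top hconn x
  refine ⟨η.fmThr I b / η.height x, ?_, ?_, ?_⟩
  · rw [ENNReal.le_div_iff_mul_le (Or.inl hw0) (Or.inl hwT)]
    calc η.ratio ^ (I + 1) * η.height x
        ≤ η.ratio ^ (I + 1) * η.ratio ^ b := by gcongr; exact hx.2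
      _ = η.fmThr I b := by rw [fmThr, ← pow_add]; ring_nf
  · rw [ENNReal.div_lt_iff (Or.inl hw0) (Or.inl hwT)]
    calc η.fmThr I b = η.ratio ^ I * η.ratio ^ (b + 1) := by rw [fmThr, ← pow_add]; ring_nf
      _ < η.ratio ^ I * η.height x :=
          ENNReal.mul_lt_mul_right (η.ratio_pow_ne_zero I) (η.ratio_pow_ne_top I) hx.1
  · exact ENNReal.mul_div_cancel hw0 hwT

/-- **The first-moment recursion**: if `k · θ ≥ 1` and, for every representative `r ∈ R`, the box
of `r` with its long mate and any bottom `h(r) a`, `a ∈ [Δ^{I+1}, Δ^I)`, is good with probability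
`≥ θ`, then `E|O_g| ≤ E|O_{g+1}|`.
[cite: Timar2006, §4 (proof of Thm. 4.3: the branching structure of T; Lemma 4.1: E[X_i] = kp)] -/
theorem tsum_measure_fmGenEvent_le_succ [Countable V] (hconn : G.Connected) (p : unitInterval)
    {I ρ k : ℕ} {θ : ℝ≥0∞} (hkθ : 1 ≤ (k : ℝ≥0∞) * θ)
    (hgood : ∀ r ∈ R, ∀ a : ℝ≥0∞, η.ratio ^ (I + 1) ≤ a → a < η.ratio ^ I →
      θ ≤ bondPercolation G p (η.boxGood r (η.longMate r) (η.height r * a) ρ k)) (g : ℕ) :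
    ∑' x, bondPercolation G p (η.fmGenEvent hR I ρ g x) ≤
      ∑' c, bondPercolation G p (η.fmGenEvent hR I ρ (g + 1) c) := by
  set μ := bondPercolation G p with hμ
  have hdecomp : ∀ c, μ (η.fmGenEvent hR I ρ (g + 1) c) =
      ∑' x, μ (η.fmGenEvent hR I ρ g x ∩ η.fmChildEvent hR I ρ (g * I) x c) := by
    intro c
    rw [fmGenEvent_succ]
    refine measure_iUnion (fun x y hxy => ?_) fun x =>
      (η.measurableSet_fmGenEvent hR I ρ g x).inter (η.measurableSet_fmChildEvent hR I ρ _ x c)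
    rw [Function.onFun, Set.disjoint_left]
    rintro ω ⟨-, hcx⟩ ⟨-, hcy⟩
    exact Set.disjoint_left.1 (η.fmChildren_disjoint hR hconn I ρ (g * I) hxy ω) hcx hcy
  have hindep : ∀ x c, μ (η.fmGenEvent hR I ρ g x ∩ η.fmChildEvent hR I ρ (g * I) x c) =
      μ (η.fmGenEvent hR I ρ g x) * μ (η.fmChildEvent hR I ρ (g * I) x c) :=
    fun x c => bondPercolation_inter_of_disjoint G p (η.iUnion_fmRegion_disjoint I g)
      (η.determinedBy_fmGenEvent hR hconn I ρ g x)
      (η.determinedBy_fmChildEvent hR hconn I ρ (g * I) x c)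
      (η.measurableSet_fmGenEvent hR I ρ g x) (η.measurableSet_fmChildEvent hR I ρ _ x c)
  have hrhs : ∑' c, μ (η.fmGenEvent hR I ρ (g + 1) c) =
      ∑' x, μ (η.fmGenEvent hR I ρ g x) * ∑' c, μ (η.fmChildEvent hR I ρ (g * I) x c) := by
    calc ∑' c, μ (η.fmGenEvent hR I ρ (g + 1) c)
        = ∑' c, ∑' x, μ (η.fmGenEvent hR I ρ g x) * μ (η.fmChildEvent hR I ρ (g * I) x c) :=
          tsum_congr fun c => by rw [hdecomp c]; exact tsum_congr fun x => hindep x c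
      _ = ∑' x, ∑' c, μ (η.fmGenEvent hR I ρ g x) * μ (η.fmChildEvent hR I ρ (g * I) x c) :=
          ENNReal.tsum_comm
      _ = ∑' x, μ (η.fmGenEvent hR I ρ g x) * ∑' c, μ (η.fmChildEvent hR I ρ (g * I) x c) :=
          tsum_congr fun x => ENNReal.tsum_mul_left
  rw [hrhs]
  refine ENNReal.tsum_le_tsum fun x => ?_
  by_cases hx : x ∈ η.slab (g * I)
  · obtain ⟨a, ha1, ha2, hxa⟩ := η.exists_relThr hconn (I := I) hx
    have hT : 1 ≤ ∑' c, μ (η.fmChildEvent hR I ρ (g * I) x c) := by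
      calc (1 : ℝ≥0∞) ≤ k * θ := hkθ
        _ ≤ k * μ (η.boxGood (rep hR x) (η.longMate (rep hR x)) (η.height (rep hR x) * a) ρ k) := by
            gcongr; exact hgood _ (rep_mem hR x) a ha1 ha2
        _ = k * μ (η.boxGood x (η.qtMate hR x) (η.fmThr I (g * I)) ρ k) := by
            rw [← hxa]
            exact congrArg (fun t => (k : ℝ≥0∞) * t)
              (η.measure_boxGood_qtMate hR hconn p x a ρ k).symm
        _ ≤ ∑' c, μ (η.fmChildEvent hR I ρ (g * I) x c) := η.mul_measure_boxGood_le_tsum hR p hx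
    calc μ (η.fmGenEvent hR I ρ g x) = μ (η.fmGenEvent hR I ρ g x) * 1 := (mul_one _).symm
      _ ≤ μ (η.fmGenEvent hR I ρ g x) * ∑' c, μ (η.fmChildEvent hR I ρ (g * I) x c) := by gcongr
  · have hempty : η.fmGenEvent hR I ρ g x = ∅ :=
      Set.eq_empty_of_forall_notMem fun ω hω => hx (η.fmGen_subset hR hconn I ρ ω g hω).1
    rw [hempty, measure_empty]
    exact bot_le

/-- Hence **`E|O_g| ≥ 1` for every generation**. [cite: Timar2006, §4 (proof of Thm. 4.3 and Lemma 4.1: E[Y_m] = 1)] -/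
theorem one_le_tsum_measure_fmGenEvent [Countable V] (hconn : G.Connected) (p : unitInterval)
    {I ρ k : ℕ} {θ : ℝ≥0∞} (hkθ : 1 ≤ (k : ℝ≥0∞) * θ)
    (hgood : ∀ r ∈ R, ∀ a : ℝ≥0∞, η.ratio ^ (I + 1) ≤ a → a < η.ratio ^ I →
      θ ≤ bondPercolation G p (η.boxGood r (η.longMate r) (η.height r * a) ρ k)) :
    ∀ g : ℕ, 1 ≤ ∑' x, bondPercolation G p (η.fmGenEvent hR I ρ g x)
  | 0 => by
    have h1 : bondPercolation G p (η.fmGenEvent hR I ρ 0 o) = 1 := by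
      rw [fmGenEvent_zero]
      simp
    calc (1 : ℝ≥0∞) = bondPercolation G p (η.fmGenEvent hR I ρ 0 o) := h1.symm
      _ ≤ ∑' x, bondPercolation G p (η.fmGenEvent hR I ρ 0 x) := ENNReal.le_tsum o
  | g + 1 => (one_le_tsum_measure_fmGenEvent hconn p hkθ hgood g).trans
      (η.tsum_measure_fmGenEvent_le_succ hR hconn p hkθ hgood g)

include hR in
/-- **`E|C(o)| = ∞`** under the hypotheses of the recursion (and depth `I ≥ 1`).
[cite: Timar2006, §4 (proof of Thm. 4.3, last paragraph)] -/
theorem tsum_measure_openConn_eq_top_of_boxGood [Countable V] (hconn : G.Connected)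
    (p : unitInterval) {I ρ k : ℕ} (hI : 1 ≤ I) {θ : ℝ≥0∞} (hkθ : 1 ≤ (k : ℝ≥0∞) * θ)
    (hgood : ∀ r ∈ R, ∀ a : ℝ≥0∞, η.ratio ^ (I + 1) ≤ a → a < η.ratio ^ I →
      θ ≤ bondPercolation G p (η.boxGood r (η.longMate r) (η.height r * a) ρ k)) :
    ∑' x, bondPercolation G p (openConn o x) = ⊤ := by
  set μ := bondPercolation G p with hμ
  have hup : ∀ x, ∑' g, μ (η.fmGenEvent hR I ρ g x) ≤ μ (openConn o x) := by
    intro x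
    have hsub : ∀ g, η.fmGenEvent hR I ρ g x ⊆ openConn o x := fun g ω hω =>
      (η.fmGen_subset hR hconn I ρ ω g hω).2
    by_cases hex : ∃ g, x ∈ η.slab (g * I)
    · obtain ⟨g₀, hg₀⟩ := hex
      have hzero : ∀ g, g ≠ g₀ → μ (η.fmGenEvent hR I ρ g x) = 0 := by
        intro g hg
        have hne : g * I ≠ g₀ * I := fun h => hg (Nat.eq_of_mul_eq_mul_right hI h)
        have hempty : η.fmGenEvent hR I ρ g x = ∅ :=
          Set.eq_empty_of_forall_notMem fun ω hω => Set.disjoint_left.1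
            (η.slab_disjoint hne) (η.fmGen_subset hR hconn I ρ ω g hω).1 hg₀
        rw [hempty, measure_empty]
      rw [tsum_eq_single g₀ hzero]
      exact measure_mono (hsub g₀)
    · push Not at hex
      have hzero : ∀ g, μ (η.fmGenEvent hR I ρ g x) = 0 := by
        intro g
        have hempty : η.fmGenEvent hR I ρ g x = ∅ := Set.eq_empty_of_forall_notMem
          fun ω hω => hex g (η.fmGen_subset hR hconn I ρ ω g hω).1
        rw [hempty, measure_empty]
      rw [ENNReal.tsum_eq_zero.2 hzero]
      exact bot_le
  refine top_le_iff.1 ?_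
  calc (⊤ : ℝ≥0∞) = ∑' _ : ℕ, (1 : ℝ≥0∞) := (ENNReal.tsum_const_eq_top_of_ne_zero one_ne_zero).symm
    _ ≤ ∑' g, ∑' x, μ (η.fmGenEvent hR I ρ g x) :=
        ENNReal.tsum_le_tsum (η.one_le_tsum_measure_fmGenEvent hR hconn p hkθ hgood)
    _ = ∑' x, ∑' g, μ (η.fmGenEvent hR I ρ g x) := ENNReal.tsum_comm
    _ ≤ ∑' x, μ (openConn o x) := ENNReal.tsum_le_tsum hup

end FirstMoment

end HeightSystem

/-! ### Theorem 4.3, quasi-transitive form -/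

/-- **Timár 2006, Thm. 4.3 for QUASI-TRANSITIVE graphs, PROVED** — "there are no infinite light
clusters in critical Bernoulli edge percolation on `G`", for `G` connected, locally finite,
quasi-transitive and nonunimodular (the light half of the quasi-transitive Cor. 5.7 quoted by
Hutchcroft 2016, §2): at `p = p_c = criticalProb G o`, almost surely every infinite open cluster
is heavy. Proof: as the transitive `Timar2006_noInfiniteLightClusters_holds`, on the heights of a
height system (`exists_heightSystem`): `0 < p_c < 1`; if light infinite clusters had positive
probability, then for every orbit representative `r` the event `F(r)` is positive
(`niceEvent_pos_of_lightCluster` for the rebased system, which includes the toppability surgery),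
`q := min_r P[F(r)] > 0`; common depth `I` and radius `ρ` make the boxes of all representatives
good with probability `≥ q/2` at `p_c` for all relative bottoms in `[Δ^{I+1}, Δ^I)`, hence
`≥ q/4` at some `p̃ < p_c`; with `k ≥ 4/q` the first-moment recursion gives `E_p̃|C(o)| = ∞`,
contradicting the finite susceptibility below `p_c` on quasi-transitive graphs
(`AntunovicVeselic2008_finiteSusceptibility_holds`).
[cite: Timar2006, Thm. 4.3 (and its proof, §4)] [cite: Hutchcroft2016, §2]
[cite: AntunovicVeselic2007, Thm. 2] -/
theorem Timar2006_noInfiniteLightClusters_quasiTransitive {V : Type} (G : SimpleGraph V)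
    [G.LocallyFinite] (hconn : G.Connected) (hqt : IsQuasiTransitive G)
    (hU : ¬ IsGraphUnimodular G) (o : V) :
    ∀ᵐ ω ∂(bondPercolation G ⟨criticalProb G o, criticalProb_mem_Icc G o⟩),
      ∀ x : V, (openCluster ω x).Infinite → IsHeavy G o (openCluster ω x) := by
  classical
  haveI : Countable V := countable_of_connected_of_locallyFinite G hconn o
  haveI : Nonempty V := ⟨o⟩
  obtain ⟨η⟩ := exists_heightSystem hconn hqt hU o
  obtain ⟨R, hR, -⟩ := hqt.exists_orbit_representatives
  set pc : unitInterval := ⟨criticalProb G o, criticalProb_mem_Icc G o⟩ with hpc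
  by_contra hnot
  have hpos : bondPercolation G pc {ω | ∃ x : V, (openCluster ω x).Infinite ∧
      ¬ IsHeavy G o (openCluster ω x)} ≠ 0 := by
    intro h0
    apply hnot
    rw [ae_iff]
    refine measure_mono_null (fun ω hω => ?_) h0
    simp only [Set.mem_setOf_eq, not_forall, exists_prop] at hω
    obtain ⟨x, hx, hl⟩ := hω
    exact ⟨x, hx, hl⟩
  set μ := bondPercolation G pc with hμ
  -- `p_c > 0`
  have hp0 : 0 < (pc : ℝ) := by
    by_contra hle
    push Not at hle
    have h0 : pc = 0 := Subtype.ext (le_antisymm hle pc.2.1)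
    apply hpos
    have hae : ∀ᵐ ω ∂(bondPercolation G pc), ¬ ∃ x : V, (openCluster ω x).Infinite ∧
        ¬ IsHeavy G o (openCluster ω x) := by
      rw [h0]
      have hall : ∀ x : V, ∀ᵐ ω ∂(bondPercolation G (0 : unitInterval)), ω ∉ percolatesAt x := by
        intro x
        have h := theta_bot G x
        rw [theta, measureReal_eq_zero_iff (measure_ne_top _ _)] at h
        exact measure_eq_zero_iff_ae_notMem.1 h
      filter_upwards [ae_all_iff.2 hall] with ω hω
      rintro ⟨x, hinf, -⟩
      exact hω x hinf
    have h := ae_iff.1 hae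
    simpa only [not_not] using h
  -- `p_c < 1`
  have hp1 : (pc : ℝ) < 1 := by
    by_contra hge
    push Not at hge
    have h1 : pc = 1 := Subtype.ext (le_antisymm pc.2.2 hge)
    apply hpos
    have hae : ∀ᵐ ω ∂(bondPercolation G pc), ¬ ∃ x : V, (openCluster ω x).Infinite ∧
        ¬ IsHeavy G o (openCluster ω x) := by
      rw [h1]
      filter_upwards [ae_forall_mem_of_one G] with ω hω
      rintro ⟨x, -, hlight⟩
      rw [openCluster_eq_univ_of_forall_mem hconn hω x] at hlight
      exact hlight (η.isHeavy_univ hconn hU)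
    have h := ae_iff.1 hae
    simpa only [not_not] using h
  -- `q_r := P[F(r)] > 0` at every representative (rebased system + toppability)
  have hqr : ∀ r : V, 0 < μ (η.niceEvent r (η.longMate r)) := by
    intro r
    set ηr := η.rebase hconn r with hηr
    have hposr : bondPercolation G pc {ω | ∃ x : V, (openCluster ω x).Infinite ∧
        ¬ IsHeavy G r (openCluster ω x)} ≠ 0 := by
      have : {ω : BondConfig V | ∃ x : V, (openCluster ω x).Infinite ∧
          ¬ IsHeavy G r (openCluster ω x)} =
          {ω | ∃ x : V, (openCluster ω x).Infinite ∧ ¬ IsHeavy G o (openCluster ω x)} := by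
        ext ω; simp only [Set.mem_setOf_eq, isHeavy_iff_of_base G hconn o r]
      rw [this]; exact hpos
    have hmate : ηr.height (η.longMate r) = ηr.ratio := by
      rw [hηr, η.height_rebase hconn, η.height_longMate, HeightSystem.ratio_rebase, mul_assoc,
        ENNReal.mul_inv_cancel (η.height_ne_zero hconn r) (η.height_ne_top hconn r), mul_one]
    have h := ηr.niceEvent_pos_of_lightCluster hconn hqt (η.adj_longMate r) hmate hp0 hp1 hposr
    rwa [hηr, η.niceEvent_rebase hconn] at h
  -- `q := min_r q_r`
  have hRne : R.Nonempty := by obtain ⟨r, hr, -⟩ := hR o; exact ⟨r, hr⟩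
  obtain ⟨r₀, hr₀, hmin⟩ := R.exists_min_image (fun r => μ (η.niceEvent r (η.longMate r))) hRne
  set q := μ (η.niceEvent r₀ (η.longMate r₀)) with hqdef
  have hq : 0 < q := hqr r₀
  have hqT : q ≠ ⊤ := measure_ne_top _ _
  have hqreal : 0 < q.toReal := ENNReal.toReal_pos hq.ne' hqT
  -- `k ≥ 4/q`, then a common depth `I ≥ 1` and radius `ρ`
  obtain ⟨k, hk⟩ : ∃ k : ℕ, 4 / q.toReal ≤ k := exists_nat_ge _
  have hevr : ∀ r ∈ R, ∀ᶠ I : ℕ in atTop, ∀ᶠ ρ : ℕ in atTop, ∀ a : ℝ≥0∞,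
      η.ratio ^ (I + 1) ≤ a → a < η.ratio ^ I →
        μ (η.niceEvent r (η.longMate r)) ≤
          2 * μ (η.boxGood r (η.longMate r) (η.height r * a) ρ k) := by
    intro r _
    set ηr := η.rebase hconn r with hηr
    have hmate : ηr.height (η.longMate r) = ηr.ratio := by
      rw [hηr, η.height_rebase hconn, η.height_longMate, HeightSystem.ratio_rebase, mul_assoc,
        ENNReal.mul_inv_cancel (η.height_ne_zero hconn r) (η.height_ne_top hconn r), mul_one]
    have h := ηr.eventually_depth_radius_boxGood_ge hconn hqt hmate hp1 k
    simp only [hηr, η.niceEvent_rebase hconn, η.boxGood_rebase hconn, HeightSystem.ratio_rebase] at h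
    exact h
  obtain ⟨I, hI1, hI⟩ := ((eventually_ge_atTop 1).and ((R.eventually_all).2 hevr)).exists
  obtain ⟨ρ, hρ⟩ := ((R.eventually_all).2 hI).exists
  -- the finite edge set read by the good events of the representatives
  have hfin : ∀ r : V, (ballSet G r (ρ + 1)).Finite := fun r => ballSet_finite G r (ρ + 1)
  set F : Finset (Sym2 V) := R.biUnion fun r =>
    ((hfin r).toFinset ×ˢ (hfin r).toFinset).image fun z => s(z.1, z.2) with hF
  have hdet : ∀ r ∈ R, ∀ a : ℝ≥0∞, a < 1 →
      DeterminedBy (η.boxGood r (η.longMate r) (η.height r * a) ρ k) (↑F : Set (Sym2 V)) := by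
    intro r hr a ha
    have hlow : η.longMate r ∈ η.lowSet r := by
      show η.height (η.longMate r) ≤ η.ratio * η.height r
      rw [η.height_longMate]
    have hrA : r ∈ η.boxSet r (η.height r * a) ρ := by
      refine η.mem_boxSet_self ?_ ρ
      calc η.height r * a < η.height r * 1 :=
            ENNReal.mul_lt_mul_right (η.height_ne_zero hconn r) (η.height_ne_top hconn r) ha
        _ = η.height r := mul_one _
    refine (η.determinedBy_boxGood hlow hrA k).mono fun e he => ?_
    obtain ⟨z, hz, rfl⟩ := η.boxEdges_subset r _ _ ρ he
    rw [hF, Finset.coe_biUnion]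
    refine Set.mem_biUnion (Finset.mem_coe.2 hr) ?_
    rw [Finset.coe_image]
    exact ⟨z, Finset.mem_coe.2 (Finset.mem_product.2
      ⟨(hfin r).mem_toFinset.2 hz.1, (hfin r).mem_toFinset.2 hz.2⟩), rfl⟩
  obtain ⟨δ, hδ, hcont⟩ :=
    exists_forall_determinedBy_abs_sub_lt G F pc (ε := q.toReal / 4) (by positivity)
  -- a parameter `p̃ < p_c` within `δ` of `p_c`
  set s : ℝ := min (δ / 2) ((pc : ℝ) / 2) with hs
  have hs0 : 0 < s := lt_min (by positivity) (by positivity)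
  have hsδ : s < δ := lt_of_le_of_lt (min_le_left _ _) (by linarith)
  have hspc : s ≤ (pc : ℝ) / 2 := min_le_right _ _
  set t : ℝ := (pc : ℝ) - s with ht
  have ht0 : 0 ≤ t := by rw [ht]; linarith
  have ht1 : t ≤ 1 := by rw [ht]; linarith [pc.2.2]
  set pt : unitInterval := ⟨t, ht0, ht1⟩ with hpt
  have htlt : (pt : ℝ) < criticalProb G o := by
    show t < (pc : ℝ)
    rw [ht]; linarith
  have hdist : dist pt pc < δ := by
    rw [Subtype.dist_eq, Real.dist_eq, show (pt : ℝ) = t from rfl, ht,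
      show (pc : ℝ) - s - pc = -s by ring, abs_neg, abs_of_pos hs0]
    exact hsδ
  -- the good events keep probability `≥ q/4` at `p̃`, at every representative
  have hgood : ∀ r ∈ R, ∀ a : ℝ≥0∞, η.ratio ^ (I + 1) ≤ a → a < η.ratio ^ I →
      ENNReal.ofReal (q.toReal / 4) ≤
        bondPercolation G pt (η.boxGood r (η.longMate r) (η.height r * a) ρ k) := by
    intro r hr a ha1 ha2
    have ha1' : a < 1 := lt_of_lt_of_le ha2 (pow_le_one' η.ratio_lt_one.le I)
    have h1 : q ≤ 2 * μ (η.boxGood r (η.longMate r) (η.height r * a) ρ k) :=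
      (hmin r hr).trans (hρ r hr a ha1 ha2)
    have h1r : q.toReal ≤ 2 * μ.real (η.boxGood r (η.longMate r) (η.height r * a) ρ k) := by
      have h := ENNReal.toReal_mono (ENNReal.mul_ne_top ENNReal.ofNat_ne_top (measure_ne_top _ _)) h1
      rwa [ENNReal.toReal_mul, ENNReal.toReal_ofNat, ← measureReal_def] at h
    have h2 := hcont pt hdist _ (hdet r hr a ha1')
    have h3 : q.toReal / 4 ≤
        (bondPercolation G pt).real (η.boxGood r (η.longMate r) (η.height r * a) ρ k) := by
      have h4 := (abs_sub_lt_iff.1 h2).2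
      linarith
    calc ENNReal.ofReal (q.toReal / 4)
        ≤ ENNReal.ofReal ((bondPercolation G pt).real
            (η.boxGood r (η.longMate r) (η.height r * a) ρ k)) := ENNReal.ofReal_le_ofReal h3
      _ = bondPercolation G pt (η.boxGood r (η.longMate r) (η.height r * a) ρ k) :=
          ofReal_measureReal (measure_ne_top _ _)
  have hkθ : 1 ≤ (k : ℝ≥0∞) * ENNReal.ofReal (q.toReal / 4) := by
    rw [← ENNReal.ofReal_natCast, ← ENNReal.ofReal_mul (Nat.cast_nonneg k), ← ENNReal.ofReal_one]
    refine ENNReal.ofReal_le_ofReal ?_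
    have hqne : q.toReal ≠ 0 := hqreal.ne'
    calc (1 : ℝ) = (4 / q.toReal) * (q.toReal / 4) := by field_simp
      _ ≤ k * (q.toReal / 4) := by gcongr
  -- `E_p̃|C(o)| = ∞` …
  have htop := η.tsum_measure_openConn_eq_top_of_boxGood hR hconn pt hI1 hkθ hgood
  -- … contradicting the finite susceptibility below `p_c`
  have hsumm := AntunovicVeselic2008_finiteSusceptibility_holds G hconn hqt o pt htlt
  have hne : ∑' x, bondPercolation G pt (openConn o x) ≠ ⊤ := by
    have h := ENNReal.ofReal_tsum_of_nonneg (fun x => measureReal_nonneg) hsumm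
    have heq : ∑' x, bondPercolation G pt (openConn o x) =
        ∑' x, ENNReal.ofReal ((bondPercolation G pt).real (openConn o x)) :=
      tsum_congr fun x => (ofReal_measureReal (measure_ne_top _ _)).symm
    rw [heq, ← h]
    exact ENNReal.ofReal_ne_top
  exact hne htop

end Literature.Barriers.CriticalPhenomena

end
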